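import Mathlib
import Summits.NavierStokesRegularity.NavierStokesRegularity.Theorems.FilamentSkeletonRssClause13LiaSymbolDerivWindowKernelDefs
import Summits.NavierStokesRegularity.NavierStokesRegularity.Theorems.FilamentSkeletonRssAnalyticStripLiaSymbolSeriesWindow
import Summits.NavierStokesRegularity.NavierStokesRegularity.Theorems.FilamentSkeletonRssClause13LiaSymbolDeriv

/-!
# Clause 13-J/13-R band window, KERNEL-ONLY and WIDER: `9x/200 ≤ 𝔖′(x)` for `41/50 ≤ x ≤ 73/20` (`Φ′ = 2C − E ≥ 9/100` for `1/6 ≤ p ≤ 67/20`)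

Hand leafhand-ns-filamentskeletonrs-7 g1 (prover), 2026-08-31, `--supports stmt-NavierStokesRegularity-23612 --as helper`; by-product of the
kernel-only `LiaSymbolBound` machinery landed for 23320's stub P3 (`…SeriesDefs/Sound/Encl/Window`).  The window of record
`…Clause13LiaSymbolDerivWindow.deriv_liaSym_ge_band` (`x ∈ [17/20, 363/100]`, ONE `native_decide`, 271 `p`-cells × 1190 `t`-nodes) is contained in
this one; here 8 exact-ℚ series nodes suffice and `cellsChkDer (9/100) nodesDer = true` is replayed by the KERNEL (`decide +kernel`; standard axioms).
Closed form `𝔖′(x) = (x/2)(2C − E)(x²/4)`: `…Clause13LiaSymbolDeriv.deriv_liaSym_eq` (lane g16).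
HONEST FRAMING: certified numerics for one explicit real integral, serving a HYPOTHETICAL filament-skeleton line on the NEGATIVE side of a
MODEL route (clause 13 ∃-side, `Clause13RNearStraightL` OPEN); nothing here bears on Navier–Stokes regularity or blow-up.
-/

set_option linter.dupNamespace false

noncomputable section

namespace Summit.NavierStokesRegularity.NavierStokesRegularity.Theorems.AnalyticStripLiaSymbol

namespace Series

open Real Set MeasureTheory Filter Topology

/-- Soundness of one band-window cell: `φ₀ ≤ 2C(p) − E(p)` for `a ≤ p ≤ b`. -/
theorem cellChkDer_sound {φ₀ a b : ℚ} {ka kb : ℤ} (h : cellChkDer φ₀ a ka b kb = true) :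
    ∀ p : ℝ, (a:ℝ) ≤ p → p ≤ (b:ℝ) → (φ₀:ℝ) ≤ 2 * Numerics.Cint p - Numerics.Eint p := by
  simp only [cellChkDer, Bool.and_eq_true, decide_eq_true_eq] at h
  obtain ⟨⟨⟨⟨ha, hab⟩, hoka⟩, hokb⟩, hD⟩ := h
  have hb : 0 < b := ha.trans_le hab
  intro p hap hpb
  have ha' : (0:ℝ) < a := by exact_mod_cast ha
  have hp : 0 < p := ha'.trans_le hap
  obtain ⟨hClo, -⟩ := C_encl b kb hb hokb
  obtain ⟨-, hEhi⟩ := E_encl a ka ha hoka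
  have hD' : (φ₀:ℝ) ≤ 2 * ((CLo b kb : ℚ) : ℝ) - ((EHi a ka : ℚ) : ℝ) := by
    have := (Rat.cast_le (K := ℝ)).mpr hD; push_cast at this; exact this
  have hCb : Numerics.Cint (b:ℝ) ≤ Numerics.Cint p := Numerics.Cint_antitone hp.le hpb
  have hEa : Numerics.Eint p ≤ Numerics.Eint (a:ℝ) := Numerics.Eint_antitone ha' hap
  linarith

/-- Soundness of the chained band-window cells on `[x.1, lastP x rest]`. -/
theorem cellsChkDer_sound {φ₀ : ℚ} : ∀ (rest : List (ℚ × ℤ)) (x : ℚ × ℤ), cellsChkDer φ₀ (x :: rest) = true → rest ≠ [] →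
    ∀ p : ℝ, (x.1:ℝ) ≤ p → p ≤ (lastP x rest : ℝ) → (φ₀:ℝ) ≤ 2 * Numerics.Cint p - Numerics.Eint p := by
  intro rest
  induction rest with
  | nil => intro x _ hne; exact absurd rfl hne
  | cons y rest ih =>
    intro x hc _ p hxp hpl
    simp only [cellsChkDer, Bool.and_eq_true] at hc
    obtain ⟨hcell, hrest⟩ := hc
    by_cases hpy : p ≤ (y.1:ℝ)
    · exact cellChkDer_sound hcell p hxp hpy
    · have hyp : (y.1:ℝ) ≤ p := le_of_lt (not_le.mp hpy)
      cases rest with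
      | nil =>
        simp only [lastP] at hpl
        exact absurd hpl hpy
      | cons z rest' =>
        exact ih y hrest (List.cons_ne_nil _ _) p hyp (by simpa [lastP] using hpl)

/-- **THE BAND-WINDOW CERTIFICATE, REPLAYED BY THE KERNEL** (`decide +kernel`; standard axioms). -/
theorem certificateDer_kernel :
    (cellsChkDer (9 / 100) nodesDer && decide (lastP ((1 : ℚ) / 6, -3) nodesDer.tail = 67 / 20)
      && decide (nodesDer = ((1 : ℚ) / 6, (-3 : ℤ)) :: nodesDer.tail)) = true := by
  decide +kernel

/-- **`Φ′(p) = 2C(p) − E(p) ≥ 9/100` for `1/6 ≤ p ≤ 67/20`, kernel-only** (contains the window of record `[0.18, 3.3]`). -/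
theorem two_Cint_sub_Eint_ge_window_kernel (p : ℝ) (h1 : 1 / 6 ≤ p) (h2 : p ≤ 67 / 20) :
    9 / 100 ≤ 2 * Numerics.Cint p - Numerics.Eint p := by
  have hc := certificateDer_kernel
  simp only [Bool.and_eq_true, decide_eq_true_eq] at hc
  obtain ⟨⟨hcells, hlast⟩, hshape⟩ := hc
  rw [hshape] at hcells
  have hne : nodesDer.tail ≠ [] := by
    intro h; rw [h] at hlast; norm_num [lastP] at hlast
  have h := cellsChkDer_sound nodesDer.tail ((1 : ℚ) / 6, -3) hcells hne p
    (by push_cast; linarith) (by rw [hlast]; push_cast; linarith)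
  have e : (((9 / 100 : ℚ) : ℝ)) = 9 / 100 := by norm_num
  rw [e] at h
  exact h

end Series

/-- **THE BAND WINDOW OF THE SELF-INDUCTION SYMBOL, KERNEL-ONLY AND WIDER: `9x/200 ≤ 𝔖′(x)` for `41/50 ≤ x ≤ 73/20`**
(standard axioms; the window of record `[17/20, 363/100]` of `…Clause13LiaSymbolDerivWindow` used `native_decide`). -/
theorem deriv_liaSym_ge_band_kernel (x : ℝ) (h1 : 41 / 50 ≤ x) (h2 : x ≤ 73 / 20) : 9 * x / 200 ≤ deriv liaSym x := by
  have hx : 0 < x := by linarith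
  rw [Numerics.deriv_liaSym_eq hx]
  have hw := Series.two_Cint_sub_Eint_ge_window_kernel (x ^ 2 / 4) (by nlinarith) (by nlinarith)
  have hx2 : 0 ≤ x / 2 := by linarith
  calc 9 * x / 200 = x / 2 * (9 / 100) := by ring
    _ ≤ x / 2 * (2 * Numerics.Cint (x ^ 2 / 4) - Numerics.Eint (x ^ 2 / 4)) := mul_le_mul_of_nonneg_left hw hx2

end Summit.NavierStokesRegularity.NavierStokesRegularity.Theorems.AnalyticStripLiaSymbol

end
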